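import Summits.AtomisticToContinuum.Crystallization.Theorems.OverbindingBudgetAffineTaylorCellProduct

/-!
# OverbindingBudget — Taylor-model cells for the far-window certificate, part 6/16 «Quadratic»

MODULE PLAN (lens-4 g68, at hand-2's landing-shape request of 2026-09-02T14:19Z, critic row 1199 (II)) of the VERIFIED g67 leaf
`OverbindingBudgetAffineTaylorCell.lean` (sha256 `dabedef39e0c5fd2…`, 4214 l, critic row 1196): this module = leaf l.1348–1659
(§5b kernel-cheap product forms, §6 degree-2 LDLᵀ certificate, §7 slot-list operations), body VERBATIM except as listed in `MAP.md`.
Same namespace `…Theorems.OverbindingBudgetAffineTaylorCell` in all 16 parts (declaration names unchanged); the parts import each other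
linearly.  No `sorry`, no `native_decide`, standard axioms; no instances/notation; scoped `set_option maxHeartbeats` with explicit bounds only.
-/

namespace Summit.AtomisticToContinuum.Crystallization.Theorems.OverbindingBudgetAffineTaylorCell

/-! ### §5b Kernel-cheap forms of the product and of the drop bound

`slotProd` scans all `126³` (pair, slot) triples — too heavy for the kernel.  `slotProdF` loops over the `126²` pairs and
touches the slot list only for the `≈ 10³` pairs of total degree `≤ 4`; `slotProdDropF` factors the drop sum.  Both are
proved EQUAL to the specification versions, so `slotProd_sound` transfers verbatim. -/

/-- `prodInner` (docstring added by the landing lane; see the module docstring). [formal bookkeeping] -/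
def prodInner (p : ℚ × Mono) (acc : List ℚ) (q : ℚ × Mono) : List ℚ :=
  if p.2.d + q.2.d ≤ 4 then List.zipWith (fun x mo => x + pairTerm p q mo) acc monos else acc

/-- `prodOuter` (docstring added by the landing lane; see the module docstring). [formal bookkeeping] -/
def prodOuter (PB : List (ℚ × Mono)) (acc : List ℚ) (p : ℚ × Mono) : List ℚ := PB.foldl (prodInner p) acc

/-- Pair-loop form of the truncated product. -/
def slotProdF (a b : List ℚ) : List ℚ := (a.zip monos).foldl (prodOuter (b.zip monos)) (monos.map fun _ => 0)

/-- `pairTerm_eq_zero_of_lt` (docstring added by the landing lane; see the module docstring). [formal bookkeeping] -/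
theorem pairTerm_eq_zero_of_lt (p q : ℚ × Mono) (mo : Mono) (hmo : mo ∈ monos) (hd : ¬ p.2.d + q.2.d ≤ 4) :
    pairTerm p q mo = 0 := by
  unfold pairTerm
  have := monos_d_le_four mo hmo
  rw [if_neg (by omega)]

/-- `prodInner_foldl` (docstring added by the landing lane; see the module docstring). [formal bookkeeping] -/
theorem prodInner_foldl (p : ℚ × Mono) (PB : List (ℚ × Mono)) (g : Mono → ℚ) :
    PB.foldl (prodInner p) (monos.map g) = monos.map fun mo => g mo + (PB.map fun q => pairTerm p q mo).sum := by
  induction PB generalizing g with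
  | nil => simp
  | cons q rest ih =>
    rw [List.foldl_cons]
    by_cases hd : p.2.d + q.2.d ≤ 4
    · have e : prodInner p (monos.map g) q = monos.map fun mo => g mo + pairTerm p q mo := by
        unfold prodInner; rw [if_pos hd, zipWith_map_self]
      rw [e, ih]
      apply List.map_congr_left; intro mo _
      simp only [List.map_cons, List.sum_cons]; ring
    · have e : prodInner p (monos.map g) q = monos.map g := by unfold prodInner; rw [if_neg hd]
      rw [e, ih]
      apply List.map_congr_left; intro mo hmo
      simp only [List.map_cons, List.sum_cons, pairTerm_eq_zero_of_lt p q mo hmo hd]; ring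

/-- `prodOuter_foldl` (docstring added by the landing lane; see the module docstring). [formal bookkeeping] -/
theorem prodOuter_foldl (PB PA : List (ℚ × Mono)) (g : Mono → ℚ) :
    PA.foldl (prodOuter PB) (monos.map g)
      = monos.map fun mo => g mo + (PA.map fun p => (PB.map fun q => pairTerm p q mo).sum).sum := by
  induction PA generalizing g with
  | nil => simp
  | cons p rest ih =>
    rw [List.foldl_cons]
    have e : prodOuter PB (monos.map g) p = monos.map fun mo => g mo + (PB.map fun q => pairTerm p q mo).sum := by
      unfold prodOuter; rw [prodInner_foldl]
    rw [e, ih]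
    apply List.map_congr_left; intro mo _
    simp only [List.map_cons, List.sum_cons]; ring

/-- `slotProdF_eq` (docstring added by the landing lane; see the module docstring). [formal bookkeeping] -/
theorem slotProdF_eq (a b : List ℚ) : slotProdF a b = slotProd a b := by
  unfold slotProdF slotProd
  rw [prodOuter_foldl]
  apply List.map_congr_left; intro mo _
  unfold slotProdCoef; ring

/-- Factored form of the drop bound. -/
def slotProdDropF (C : Cell) (a b : List ℚ) : ℚ :=
  ((a.zip monos).map fun p => |p.1| * p.2.hv C *
    (((b.zip monos).map fun q => if 4 < p.2.d + q.2.d then |q.1| * q.2.hv C else 0).sum)).sum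

/-- `slotProdDropF_eq` (docstring added by the landing lane; see the module docstring). [formal bookkeeping] -/
theorem slotProdDropF_eq (C : Cell) (a b : List ℚ) : slotProdDropF C a b = slotProdDrop C a b := by
  unfold slotProdDropF slotProdDrop
  congr 1; apply List.map_congr_left; intro p _
  rw [← List.sum_map_mul_left]
  congr 1; apply List.map_congr_left; intro q _
  split_ifs <;> ring

/-! ## §6 The degree-2 part: quadratic forms, an `LDLᵀ`-type certificate with exact residual, and the box loss

The degree-2 slots of the certificate polynomial `Q` form a quadratic form `M`.  The row supplies `d_k ≥ 0` and a unit
lower-triangular `L` (any rationals); `R(t) = Σ_k d_k (t_k + Σ_{i>k} l_{ik} t_i)² ≥ 0` has the explicit coefficient form `P.qf`,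
and the RESIDUAL `E = M − P.qf` is bounded on the box by `quadLoss = Σ |E_ij| h_i h_j`.  So `M(t) ≥ −quadLoss` — no equalities
are checked, rounding in the generator's `LDLᵀ` is harmless, and an indefinite `M` (large dilations) is handled by the same rule. -/

/-- `QF` (docstring added by the landing lane; see the module docstring). [formal bookkeeping] -/
structure QF where
  m11 : ℚ
  m22 : ℚ
  m33 : ℚ
  m44 : ℚ
  m55 : ℚ
  m12 : ℚ
  m13 : ℚ
  m14 : ℚ
  m15 : ℚ
  m23 : ℚ
  m24 : ℚ
  m25 : ℚ
  m34 : ℚ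
  m35 : ℚ
  m45 : ℚ

/-- `QF.eval` (docstring added by the landing lane; see the module docstring). [formal bookkeeping] -/
def QF.eval (M : QF) (t1 t2 t3 t4 t5 : ℝ) : ℝ :=
  (M.m11 : ℝ) * (t1 * t1) + (M.m22 : ℝ) * (t2 * t2) + (M.m33 : ℝ) * (t3 * t3) + (M.m44 : ℝ) * (t4 * t4)
    + (M.m55 : ℝ) * (t5 * t5) + (M.m12 : ℝ) * (t1 * t2) + (M.m13 : ℝ) * (t1 * t3) + (M.m14 : ℝ) * (t1 * t4)
    + (M.m15 : ℝ) * (t1 * t5) + (M.m23 : ℝ) * (t2 * t3) + (M.m24 : ℝ) * (t2 * t4) + (M.m25 : ℝ) * (t2 * t5)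
    + (M.m34 : ℝ) * (t3 * t4) + (M.m35 : ℝ) * (t3 * t5) + (M.m45 : ℝ) * (t4 * t5)

/-- `PSDCert` (docstring added by the landing lane; see the module docstring). [formal bookkeeping] -/
structure PSDCert where
  d1 : ℚ
  d2 : ℚ
  d3 : ℚ
  d4 : ℚ
  d5 : ℚ
  l21 : ℚ
  l31 : ℚ
  l32 : ℚ
  l41 : ℚ
  l42 : ℚ
  l43 : ℚ
  l51 : ℚ
  l52 : ℚ
  l53 : ℚ
  l54 : ℚ

/-- `R(t) = Σ_k d_k (t_k + Σ_{i>k} l_{ik} t_i)²`. -/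
def PSDCert.R (P : PSDCert) (t1 t2 t3 t4 t5 : ℝ) : ℝ :=
  (P.d1 : ℝ) * (t1 + P.l21 * t2 + P.l31 * t3 + P.l41 * t4 + P.l51 * t5) ^ 2
    + (P.d2 : ℝ) * (t2 + P.l32 * t3 + P.l42 * t4 + P.l52 * t5) ^ 2
    + (P.d3 : ℝ) * (t3 + P.l43 * t4 + P.l53 * t5) ^ 2 + (P.d4 : ℝ) * (t4 + P.l54 * t5) ^ 2 + (P.d5 : ℝ) * t5 ^ 2

/-- The coefficient form of `R` (= `L D Lᵀ`). -/
def PSDCert.qf (P : PSDCert) : QF :=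
  { m11 := P.d1
    m22 := P.d1 * P.l21 ^ 2 + P.d2
    m33 := P.d1 * P.l31 ^ 2 + P.d2 * P.l32 ^ 2 + P.d3
    m44 := P.d1 * P.l41 ^ 2 + P.d2 * P.l42 ^ 2 + P.d3 * P.l43 ^ 2 + P.d4
    m55 := P.d1 * P.l51 ^ 2 + P.d2 * P.l52 ^ 2 + P.d3 * P.l53 ^ 2 + P.d4 * P.l54 ^ 2 + P.d5
    m12 := 2 * (P.d1 * P.l21)
    m13 := 2 * (P.d1 * P.l31)
    m14 := 2 * (P.d1 * P.l41)
    m15 := 2 * (P.d1 * P.l51)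
    m23 := 2 * (P.d1 * P.l21 * P.l31 + P.d2 * P.l32)
    m24 := 2 * (P.d1 * P.l21 * P.l41 + P.d2 * P.l42)
    m25 := 2 * (P.d1 * P.l21 * P.l51 + P.d2 * P.l52)
    m34 := 2 * (P.d1 * P.l31 * P.l41 + P.d2 * P.l32 * P.l42 + P.d3 * P.l43)
    m35 := 2 * (P.d1 * P.l31 * P.l51 + P.d2 * P.l32 * P.l52 + P.d3 * P.l53)
    m45 := 2 * (P.d1 * P.l41 * P.l51 + P.d2 * P.l42 * P.l52 + P.d3 * P.l43 * P.l53 + P.d4 * P.l54) }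

/-- `PSDCert.R_eq` (docstring added by the landing lane; see the module docstring). [formal bookkeeping] -/
theorem PSDCert.R_eq (P : PSDCert) (t1 t2 t3 t4 t5 : ℝ) : P.R t1 t2 t3 t4 t5 = P.qf.eval t1 t2 t3 t4 t5 := by
  simp only [PSDCert.R, PSDCert.qf, QF.eval]
  push_cast
  ring

/-- `PSDCert.dOK` (docstring added by the landing lane; see the module docstring). [formal bookkeeping] -/
def PSDCert.dOK (P : PSDCert) : Bool :=
  decide (0 ≤ P.d1) && decide (0 ≤ P.d2) && decide (0 ≤ P.d3) && decide (0 ≤ P.d4) && decide (0 ≤ P.d5)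

/-- `PSDCert.R_nonneg` (docstring added by the landing lane; see the module docstring). [formal bookkeeping] -/
theorem PSDCert.R_nonneg (P : PSDCert) (hd : P.dOK = true) (t1 t2 t3 t4 t5 : ℝ) : 0 ≤ P.R t1 t2 t3 t4 t5 := by
  simp only [PSDCert.dOK, Bool.and_eq_true, decide_eq_true_eq] at hd
  obtain ⟨⟨⟨⟨h1, h2⟩, h3⟩, h4⟩, h5⟩ := hd
  have h1' : (0 : ℝ) ≤ P.d1 := by exact_mod_cast h1
  have h2' : (0 : ℝ) ≤ P.d2 := by exact_mod_cast h2
  have h3' : (0 : ℝ) ≤ P.d3 := by exact_mod_cast h3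
  have h4' : (0 : ℝ) ≤ P.d4 := by exact_mod_cast h4
  have h5' : (0 : ℝ) ≤ P.d5 := by exact_mod_cast h5
  unfold PSDCert.R
  have := sq_nonneg (t1 + P.l21 * t2 + P.l31 * t3 + P.l41 * t4 + P.l51 * t5)
  have := sq_nonneg (t2 + P.l32 * t3 + P.l42 * t4 + P.l52 * t5)
  have := sq_nonneg (t3 + P.l43 * t4 + P.l53 * t5)
  have := sq_nonneg (t4 + P.l54 * t5)
  have := sq_nonneg t5
  positivity

/-- Entrywise difference of two forms. -/
def QF.sub (M N : QF) : QF :=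
  ⟨M.m11 - N.m11, M.m22 - N.m22, M.m33 - N.m33, M.m44 - N.m44, M.m55 - N.m55, M.m12 - N.m12, M.m13 - N.m13,
    M.m14 - N.m14, M.m15 - N.m15, M.m23 - N.m23, M.m24 - N.m24, M.m25 - N.m25, M.m34 - N.m34, M.m35 - N.m35, M.m45 - N.m45⟩

/-- `QF.eval_sub` (docstring added by the landing lane; see the module docstring). [formal bookkeeping] -/
theorem QF.eval_sub (M N : QF) (t1 t2 t3 t4 t5 : ℝ) :
    (M.sub N).eval t1 t2 t3 t4 t5 = M.eval t1 t2 t3 t4 t5 - N.eval t1 t2 t3 t4 t5 := by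
  simp only [QF.sub, QF.eval]; push_cast; ring

/-- Box loss of a form: `Σ |m_ij| h_i h_j`. -/
def QF.boxLoss (E : QF) (C : Cell) : ℚ :=
  |E.m11| * (C.h1 * C.h1) + |E.m22| * (C.h2 * C.h2) + |E.m33| * (C.h3 * C.h3) + |E.m44| * (C.h4 * C.h4)
    + |E.m55| * (C.h5 * C.h5) + |E.m12| * (C.h1 * C.h2) + |E.m13| * (C.h1 * C.h3) + |E.m14| * (C.h1 * C.h4)
    + |E.m15| * (C.h1 * C.h5) + |E.m23| * (C.h2 * C.h3) + |E.m24| * (C.h2 * C.h4) + |E.m25| * (C.h2 * C.h5)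
    + |E.m34| * (C.h3 * C.h4) + |E.m35| * (C.h3 * C.h5) + |E.m45| * (C.h4 * C.h5)

/-- `qterm_ge` (docstring added by the landing lane; see the module docstring). [formal bookkeeping] -/
theorem qterm_ge (e : ℚ) {x y : ℝ} {hx hy : ℚ} (h1 : |x| ≤ hx) (h2 : |y| ≤ hy) :
    -((|e| * (hx * hy) : ℚ) : ℝ) ≤ (e : ℝ) * (x * y) := by
  have hb : |(e : ℝ) * (x * y)| ≤ ((|e| * (hx * hy) : ℚ) : ℝ) := by
    push_cast
    rw [abs_mul, abs_mul]
    exact mul_le_mul_of_nonneg_left (mul_le_mul h1 h2 (abs_nonneg _) ((abs_nonneg _).trans h1)) (abs_nonneg _)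
  have := neg_abs_le ((e : ℝ) * (x * y))
  linarith

/-- `QF.eval_ge_neg_boxLoss` (docstring added by the landing lane; see the module docstring). [formal bookkeeping] -/
theorem QF.eval_ge_neg_boxLoss (E : QF) (C : Cell) (t1 t2 t3 t4 t5 : ℝ)
    (h1 : |t1| ≤ C.h1) (h2 : |t2| ≤ C.h2) (h3 : |t3| ≤ C.h3) (h4 : |t4| ≤ C.h4) (h5 : |t5| ≤ C.h5) :
    -(E.boxLoss C : ℝ) ≤ E.eval t1 t2 t3 t4 t5 := by
  have e11 := qterm_ge E.m11 h1 h1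
  have e22 := qterm_ge E.m22 h2 h2
  have e33 := qterm_ge E.m33 h3 h3
  have e44 := qterm_ge E.m44 h4 h4
  have e55 := qterm_ge E.m55 h5 h5
  have e12 := qterm_ge E.m12 h1 h2
  have e13 := qterm_ge E.m13 h1 h3
  have e14 := qterm_ge E.m14 h1 h4
  have e15 := qterm_ge E.m15 h1 h5
  have e23 := qterm_ge E.m23 h2 h3
  have e24 := qterm_ge E.m24 h2 h4
  have e25 := qterm_ge E.m25 h2 h5
  have e34 := qterm_ge E.m34 h3 h4
  have e35 := qterm_ge E.m35 h3 h5
  have e45 := qterm_ge E.m45 h4 h5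
  unfold QF.boxLoss QF.eval
  push_cast at *
  linarith

/-- THE DEGREE-2 RULE: `M(t) ≥ −boxLoss(M − LDLᵀ)` on the box, for any certificate with `d ≥ 0`. -/
theorem QF.eval_ge_of_cert (M : QF) (P : PSDCert) (hd : P.dOK = true) (C : Cell) (t1 t2 t3 t4 t5 : ℝ)
    (h1 : |t1| ≤ C.h1) (h2 : |t2| ≤ C.h2) (h3 : |t3| ≤ C.h3) (h4 : |t4| ≤ C.h4) (h5 : |t5| ≤ C.h5) :
    -((M.sub P.qf).boxLoss C : ℝ) ≤ M.eval t1 t2 t3 t4 t5 := by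
  have hR := P.R_nonneg hd t1 t2 t3 t4 t5
  rw [P.R_eq] at hR
  have hE := (M.sub P.qf).eval_ge_neg_boxLoss C t1 t2 t3 t4 t5 h1 h2 h3 h4 h5
  rw [QF.eval_sub] at hE
  linarith

/-! ## §7 Slot-list operations of the certificate and the degree split of a slot polynomial on the box -/

/-- Add a constant (slot of degree `0`). -/
def addConst (q : List ℚ) (κ : ℚ) : List ℚ := List.zipWith (fun a mo => a + if mo.d = 0 then κ else 0) q monos

/-- `addConst_map` (docstring added by the landing lane; see the module docstring). [formal bookkeeping] -/
theorem addConst_map (f : Mono → ℚ) (κ : ℚ) :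
    addConst (monos.map f) κ = monos.map fun mo => f mo + if mo.d = 0 then κ else 0 := by
  unfold addConst; rw [zipWith_map_self]

/-- `zipWith_map_map` (docstring added by the landing lane; see the module docstring). [formal bookkeeping] -/
theorem zipWith_map_map {α β γ δ : Type*} (F : β → γ → δ) (f : α → β) (g : α → γ) (l : List α) :
    List.zipWith F (l.map f) (l.map g) = l.map fun a => F (f a) (g a) := by
  induction l with
  | nil => rfl
  | cons a l ih => simp [ih]

/-- Slotwise `A·v − B·w`. -/
def linComb (A B : ℚ) (v w : List ℚ) : List ℚ := List.zipWith (fun x y => A * x - B * y) v w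

/-- `linComb_map` (docstring added by the landing lane; see the module docstring). [formal bookkeeping] -/
theorem linComb_map (A B : ℚ) (f g : Mono → ℚ) :
    linComb A B (monos.map f) (monos.map g) = monos.map fun mo => A * f mo - B * g mo := by
  unfold linComb; rw [zipWith_map_map]

/-- `map_zip_self` (docstring added by the landing lane; see the module docstring). [formal bookkeeping] -/
theorem map_zip_self {α β : Type*} (f : α → β) (l : List α) : (l.map f).zip l = l.map fun a => (f a, a) := by
  induction l with
  | nil => rfl
  | cons a l ih => simp [ih]

/-- Corner sum over the slots of degree `∉ {0, 2}`: `Σ |q_α| h^α`. -/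
def cornerSum (C : Cell) (q : List ℚ) : ℚ :=
  ((q.zip monos).map fun p => if p.2.d = 0 ∨ p.2.d = 2 then 0 else |p.1| * p.2.hv C).sum

/-- `cornerSum_map` (docstring added by the landing lane; see the module docstring). [formal bookkeeping] -/
theorem cornerSum_map (C : Cell) (f : Mono → ℚ) :
    cornerSum C (monos.map f) = (monos.map fun mo => if mo.d = 0 ∨ mo.d = 2 then 0 else |f mo| * mo.hv C).sum := by
  unfold cornerSum; rw [map_zip_self, List.map_map]; rfl

/-- The constant slot and the 15 degree-2 slots, read off a coefficient function / a slot list. -/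
def slot0 : Mono := ⟨0, 0, 0, 0, 0, 0, 1⟩
/-- `qfOf` (docstring added by the landing lane; see the module docstring). [formal bookkeeping] -/
def qfOf (f : Mono → ℚ) : QF :=
  ⟨f ⟨2, 2, 0, 0, 0, 0, 1⟩, f ⟨2, 0, 2, 0, 0, 0, 1⟩, f ⟨2, 0, 0, 2, 0, 0, 1⟩, f ⟨2, 0, 0, 0, 2, 0, 1⟩, f ⟨2, 0, 0, 0, 0, 2, 1⟩,
    f ⟨2, 1, 1, 0, 0, 0, 2⟩, f ⟨2, 1, 0, 1, 0, 0, 2⟩, f ⟨2, 1, 0, 0, 1, 0, 2⟩, f ⟨2, 1, 0, 0, 0, 1, 2⟩, f ⟨2, 0, 1, 1, 0, 0, 2⟩,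
    f ⟨2, 0, 1, 0, 1, 0, 2⟩, f ⟨2, 0, 1, 0, 0, 1, 2⟩, f ⟨2, 0, 0, 1, 1, 0, 2⟩, f ⟨2, 0, 0, 1, 0, 1, 2⟩, f ⟨2, 0, 0, 0, 1, 1, 2⟩⟩
/-- `qfOfList` (docstring added by the landing lane; see the module docstring). [formal bookkeeping] -/
def qfOfList (q : List ℚ) : QF :=
  ⟨q[6]!, q[11]!, q[15]!, q[18]!, q[20]!, q[7]!, q[8]!, q[9]!, q[10]!, q[12]!, q[13]!, q[14]!, q[16]!, q[17]!, q[19]!⟩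

/-- `qfOfList_map` (docstring added by the landing lane; see the module docstring). [formal bookkeeping] -/
theorem qfOfList_map (f : Mono → ℚ) : qfOfList (monos.map f) = qfOf f := rfl
/-- `getZero_map` (docstring added by the landing lane; see the module docstring). [formal bookkeeping] -/
theorem getZero_map (f : Mono → ℚ) : (monos.map f)[0]! = f slot0 := rfl

set_option maxHeartbeats 4000000 in
/-- DEGREE SPLIT (the kept part): constant slot + quadratic form. -/
theorem kept_sum_eq (f : Mono → ℚ) (t1 t2 t3 t4 t5 : ℝ) :
    (monos.map fun mo => if mo.d = 0 ∨ mo.d = 2 then (f mo : ℝ) * mo.ev t1 t2 t3 t4 t5 else 0).sum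
      = (f slot0 : ℝ) + (qfOf f).eval t1 t2 t3 t4 t5 := by
  simp only [monos, List.map_cons, List.map_nil, List.sum_cons, List.sum_nil, Mono.ev, qfOf, QF.eval, slot0,
    Nat.reduceEqDiff, or_self, or_false, or_true, if_true, if_false, pow_zero, pow_one, mul_one, one_mul, add_zero, zero_add]
  ring

/-- LOWER BOUND OF A SLOT POLYNOMIAL ON THE BOX: constant + quadratic form − corner sum of the other slots. -/
theorem evalCoef_map_ge (C : Cell) (f : Mono → ℚ) (t1 t2 t3 t4 t5 : ℝ)
    (h1 : |t1| ≤ C.h1) (h2 : |t2| ≤ C.h2) (h3 : |t3| ≤ C.h3) (h4 : |t4| ≤ C.h4) (h5 : |t5| ≤ C.h5) :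
    (f slot0 : ℝ) + (qfOf f).eval t1 t2 t3 t4 t5 - (cornerSum C (monos.map f) : ℝ)
      ≤ evalCoef (monos.map f) t1 t2 t3 t4 t5 := by
  rw [evalCoef_monos_map, ← kept_sum_eq, cornerSum_map, Rat.cast_list_sum, List.map_map, list_sum_map_sub]
  apply list_sum_le_sum
  intro mo _
  simp only [Function.comp]
  by_cases hk : mo.d = 0 ∨ mo.d = 2
  · rw [if_pos hk, if_pos hk]; push_cast; simp
  · rw [if_neg hk, if_neg hk]
    have hev := mo.ev_abs_le_hv C t1 t2 t3 t4 t5 h1 h2 h3 h4 h5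
    have hb : |(f mo : ℝ) * mo.ev t1 t2 t3 t4 t5| ≤ ((|f mo| * mo.hv C : ℚ) : ℝ) := by
      push_cast; rw [abs_mul]; exact mul_le_mul_of_nonneg_left hev (abs_nonneg _)
    have := neg_abs_le ((f mo : ℝ) * mo.ev t1 t2 t3 t4 t5)
    linarith

/-- `evalCoef_addConst` (docstring added by the landing lane; see the module docstring). [formal bookkeeping] -/
theorem evalCoef_addConst (f : Mono → ℚ) (κ : ℚ) (t1 t2 t3 t4 t5 : ℝ) :
    evalCoef (addConst (monos.map f) κ) t1 t2 t3 t4 t5 = evalCoef (monos.map f) t1 t2 t3 t4 t5 + κ := by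
  rw [addConst_map, evalCoef_monos_map, evalCoef_monos_map]
  have hκ : (monos.map fun mo => (if mo.d = 0 then (κ : ℝ) else 0) * mo.ev t1 t2 t3 t4 t5).sum = κ := by
    simp [monos, Mono.ev]
  rw [← hκ, ← List.sum_map_add]
  congr 1; apply List.map_congr_left; intro mo _
  push_cast
  split_ifs <;> push_cast <;> ring

/-- `evalCoef_linComb` (docstring added by the landing lane; see the module docstring). [formal bookkeeping] -/
theorem evalCoef_linComb (A B : ℚ) (f g : Mono → ℚ) (t1 t2 t3 t4 t5 : ℝ) :
    evalCoef (linComb A B (monos.map f) (monos.map g)) t1 t2 t3 t4 t5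
      = A * evalCoef (monos.map f) t1 t2 t3 t4 t5 - B * evalCoef (monos.map g) t1 t2 t3 t4 t5 := by
  rw [linComb_map, evalCoef_monos_map, evalCoef_monos_map, evalCoef_monos_map, mul_list_sum, mul_list_sum,
    list_sum_map_sub]
  congr 1; apply List.map_congr_left; intro mo _
  push_cast; ring

end Summit.AtomisticToContinuum.Crystallization.Theorems.OverbindingBudgetAffineTaylorCell
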